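import Summits.ResolutionOfSingularities.ResolutionOfSingularities.Theorems.EquisingularLiftEquisingularLiftNatTowerReachSsDefs
import Summits.ResolutionOfSingularities.ResolutionOfSingularities.Theorems.EquisingularLiftEquisingularLiftNatResidueHypDefs
import HarnessLib

/-!
# [OURS · L1 W4.5(b) · EL♮(3)] NOSE RESIDUE STRUCTURE, brick 1a — the ten negated hypotheses of the non-isolated residue
# `stub_elnat_three_nonisolated_nonDefNoseTowerBTriplePrime`, UNFOLDED to their geometric clauses

Cell `res-hironaka`, rung L, slot W4.5(b), D-0157 DOOR 1 width seat `res-L1-w45b-nose-w4` (desk WIDTH TABLE D1, 2026-08-28T14:38:46Z, row nose-w4);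
crux CHILD EL♮(3) = stmt-ResolutionOfSingularities-20148 (parent EL♮ stmt-…-20038), registered skeleton CHILD v40 (34th registration). OURS; NOT a
statement of any manuscript; nothing of [Hironaka2017] is asserted or used; AI kernel work, weaker than expert review. Resolution of singularities in
positive characteristic is NOT proved here (dimension 3 is a theorem in print, Cossart–Piltant 2008/2009; this is bookkeeping for OUR kernel-own route).
Pure logic over the tree's definitions (no `sorry`, no new definition, no instance, no notation; standard axioms).
`--kind proof --supports stmt-ResolutionOfSingularities-20148 --as helper`.

The registered nose residue carries, after the common binders (`ι : H ↪ ℙⁿ_k` an integral hypersurface, `n = 3`, `H` not regular, its non-regular locus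
infinite), the ten negations `¬ NoseHypCI → ¬ NoseHypDet → ¬ NoseHypLiftClass → ¬ NoseHypLiftClassTwo → ¬ ReachNoseTower₄ → ¬ ReachNoseTower₇ →
¬ ReachNoseTowerB → ¬ ReachNoseTowerBPrime → ¬ ReachNoseTowerBDoublePrime → ¬ ReachNoseTowerBTriplePrime` (all at `k n H ι`; definitions in
`…NatResidueHypDefs`, `…NatTowerRoundThreeDefs`, `…NatNoseTowerSevenDefs`, `…NatTowerRoundB{,Prime,DoublePrime}Defs`, `…NatTowerReachSsDefs`).
Every one of them is an ∃-prefix blob «there is a nose `Z` of class X inside `ι(H)`, not all of it, whose blow-up followed by SOME chain of X's engine ends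
with a regular reduced strict transform».  THIS FILE: for each of the ten, `not_X_iff : ¬ X k n H ι ↔ ∀ (nose data of X's class) (blow-up of the nose)
(stage reached by X's engine), ¬ (the reached reduced strict transform is regular)` — the geometric clause an `H` with non-isolated singularities satisfies
when it ESCAPES engine X (curried negation, proved by anonymous-constructor packing/unpacking; no `simp`, no `push_neg`).  The formal inclusions among
the ten, the THREE-MEMBER CORE of the list and the one-shot corollary are in the sister file `…NatNoseResidueCore` (brick 1b).
Companion memo (typed ≠ proved): `run/shared/lean/pub/res-hironaka/L/res-L1-w45b-nose-w4/NOSE-RESIDUE-CENSUS.md`.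
-/

set_option linter.dupNamespace false

noncomputable section

open CategoryTheory CategoryTheory.Limits AlgebraicGeometry TopologicalSpace Topology IsLocalRing
open Literature.AlgebraicGeometry.Resolution
open AlgebraicGeometry.Scheme.IdealSheafData

namespace Summit.ResolutionOfSingularities.ResolutionOfSingularities.Cruxes.EquisingularLiftNat.Sections

/-! ## §1 The ten negated nose hypotheses, unfolded -/

/-- **`¬ ReachNoseTowerBTriplePrime`, unfolded** (blob #last of the registered nose residue, T23-A‴ «FIBRE PAIRS» engine): `H` escapes the B‴ nose tower iff
for every closed INFINITE CURVE `Z ⊊ ι(H)` of the liftable nose class₂, every blow-up `υ` of `Z`, and every stage `(F', γ', T', E', Es', Ns', K')` reached from the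
seed `(F₂, 𝟙, closure υ⁻¹(ι(H) ∖ Z), υ⁻¹Z, [], [], ∅)` by B‴ point steps (`TowerPtRegB₄` / `TowerPtRamB₄`) and B‴ rounds (`TowerRoundBTriplePrime`), the reduced
strict transform `closure T'` is NOT regular. [OURS · L1 W4.5b · pure logic] -/
theorem not_reachNoseTowerBTriplePrime_iff (k : Type) [Field k] (n : ℕ) (H : Scheme.{0})
    (ι : H ⟶ (Literature.AlgebraicGeometry.Motives.projectiveSpace n k).left) :
    ¬ ReachNoseTowerBTriplePrime k n H ι ↔
      ∀ (Z : Set (Literature.AlgebraicGeometry.Motives.projectiveSpace n k).left) (hZ : IsClosed Z),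
        IsLiftableNoseClass₂ k n Z → Z ⊆ Set.range ι → ¬ (Set.range ι ⊆ Z) → Z.Infinite →
        (∀ z : ↥(redSub (Literature.AlgebraicGeometry.Motives.projectiveSpace n k).left Z hZ),
          IsClosed ({z} : Set ↥(redSub (Literature.AlgebraicGeometry.Motives.projectiveSpace n k).left Z hZ)) →
            ringKrullDim ((redSub (Literature.AlgebraicGeometry.Motives.projectiveSpace n k).left Z hZ).presheaf.stalk z) =
              ((1 : ℕ) : WithBot ℕ∞)) →
        ∀ (F₂ : Scheme.{0}) (υ : F₂ ⟶ (Literature.AlgebraicGeometry.Motives.projectiveSpace n k).left),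
          IsBlowup υ (Scheme.IdealSheafData.vanishingIdeal
            (⟨Z, hZ⟩ : Closeds (Literature.AlgebraicGeometry.Motives.projectiveSpace n k).left)) →
          ∀ (F' : Scheme.{0}) (γ' : F' ⟶ F₂) (T' E' : Set F') (Es' Ns' : List (Set F')) (K' : Set F'),
            (∀ R : (∀ G : Scheme.{0}, (G ⟶ F₂) → Set G → Set G → List (Set G) → List (Set G) → Set G → Prop),
              R F₂ (𝟙 F₂) (closure (υ ⁻¹' (Set.range ι \ Z))) (υ ⁻¹' Z) [] [] ∅ →
              TowerPtRegB₄ F₂ R →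
              TowerPtRamB₄ F₂ R →
              TowerRoundBTriplePrime (Literature.AlgebraicGeometry.Motives.projectiveSpace n k).left F₂ υ Z hZ R →
              R F' γ' T' E' Es' Ns' K') →
            ¬ Literature.AlgebraicGeometry.Resolution.Scheme.IsRegular (redSub F' (closure T') isClosed_closure) := by
  constructor
  · intro h Z hZ h1 h2 h3 h4 h5 F₂ υ hυ F' γ' T' E' Es' Ns' K' hcl hreg
    exact h ⟨Z, hZ, h1, h2, h3, h4, h5, F₂, υ, hυ, F', γ', T', E', Es', Ns', K', hcl, hreg⟩
  · rintro h ⟨Z, hZ, h1, h2, h3, h4, h5, F₂, υ, hυ, F', γ', T', E', Es', Ns', K', hcl, hreg⟩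
    exact h Z hZ h1 h2 h3 h4 h5 F₂ υ hυ F' γ' T' E' Es' Ns' K' hcl hreg

/-- **`¬ ReachNoseTowerBDoublePrime`, unfolded** (T23-A″ «PAIR ROUNDS» engine): as `not_reachNoseTowerBTriplePrime_iff` with ONE retained list and the
B-point steps `TowerPtRegB` / `TowerPtRamB` and B″ rounds `TowerRoundBDoublePrime`. [OURS · L1 W4.5b · pure logic] -/
theorem not_reachNoseTowerBDoublePrime_iff (k : Type) [Field k] (n : ℕ) (H : Scheme.{0})
    (ι : H ⟶ (Literature.AlgebraicGeometry.Motives.projectiveSpace n k).left) :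
    ¬ ReachNoseTowerBDoublePrime k n H ι ↔
      ∀ (Z : Set (Literature.AlgebraicGeometry.Motives.projectiveSpace n k).left) (hZ : IsClosed Z),
        IsLiftableNoseClass₂ k n Z → Z ⊆ Set.range ι → ¬ (Set.range ι ⊆ Z) → Z.Infinite →
        (∀ z : ↥(redSub (Literature.AlgebraicGeometry.Motives.projectiveSpace n k).left Z hZ),
          IsClosed ({z} : Set ↥(redSub (Literature.AlgebraicGeometry.Motives.projectiveSpace n k).left Z hZ)) →
            ringKrullDim ((redSub (Literature.AlgebraicGeometry.Motives.projectiveSpace n k).left Z hZ).presheaf.stalk z) =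
              ((1 : ℕ) : WithBot ℕ∞)) →
        ∀ (F₂ : Scheme.{0}) (υ : F₂ ⟶ (Literature.AlgebraicGeometry.Motives.projectiveSpace n k).left),
          IsBlowup υ (Scheme.IdealSheafData.vanishingIdeal
            (⟨Z, hZ⟩ : Closeds (Literature.AlgebraicGeometry.Motives.projectiveSpace n k).left)) →
          ∀ (F' : Scheme.{0}) (γ' : F' ⟶ F₂) (T' E' : Set F') (Es' : List (Set F')) (K' : Set F'),
            (∀ R : (∀ G : Scheme.{0}, (G ⟶ F₂) → Set G → Set G → List (Set G) → Set G → Prop),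
              R F₂ (𝟙 F₂) (closure (υ ⁻¹' (Set.range ι \ Z))) (υ ⁻¹' Z) [] ∅ →
              TowerPtRegB (Literature.AlgebraicGeometry.Motives.projectiveSpace n k).left F₂ υ R →
              TowerPtRamB (Literature.AlgebraicGeometry.Motives.projectiveSpace n k).left F₂ υ R →
              TowerRoundBDoublePrime (Literature.AlgebraicGeometry.Motives.projectiveSpace n k).left F₂ υ Z hZ R →
              R F' γ' T' E' Es' K') →
            ¬ Literature.AlgebraicGeometry.Resolution.Scheme.IsRegular (redSub F' (closure T') isClosed_closure) := by
  constructor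
  · intro h Z hZ h1 h2 h3 h4 h5 F₂ υ hυ F' γ' T' E' Es' K' hcl hreg
    exact h ⟨Z, hZ, h1, h2, h3, h4, h5, F₂, υ, hυ, F', γ', T', E', Es', K', hcl, hreg⟩
  · rintro h ⟨Z, hZ, h1, h2, h3, h4, h5, F₂, υ, hυ, F', γ', T', E', Es', K', hcl, hreg⟩
    exact h Z hZ h1 h2 h3 h4 h5 F₂ υ hυ F' γ' T' E' Es' K' hcl hreg

/-- **`¬ ReachNoseTowerBPrime`, unfolded** (T23-A′ «B-TRACE» engine): B-point steps and B′ rounds `TowerRoundBPrime`. [OURS · L1 W4.5b · pure logic] -/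
theorem not_reachNoseTowerBPrime_iff (k : Type) [Field k] (n : ℕ) (H : Scheme.{0})
    (ι : H ⟶ (Literature.AlgebraicGeometry.Motives.projectiveSpace n k).left) :
    ¬ ReachNoseTowerBPrime k n H ι ↔
      ∀ (Z : Set (Literature.AlgebraicGeometry.Motives.projectiveSpace n k).left) (hZ : IsClosed Z),
        IsLiftableNoseClass₂ k n Z → Z ⊆ Set.range ι → ¬ (Set.range ι ⊆ Z) → Z.Infinite →
        (∀ z : ↥(redSub (Literature.AlgebraicGeometry.Motives.projectiveSpace n k).left Z hZ),
          IsClosed ({z} : Set ↥(redSub (Literature.AlgebraicGeometry.Motives.projectiveSpace n k).left Z hZ)) →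
            ringKrullDim ((redSub (Literature.AlgebraicGeometry.Motives.projectiveSpace n k).left Z hZ).presheaf.stalk z) =
              ((1 : ℕ) : WithBot ℕ∞)) →
        ∀ (F₂ : Scheme.{0}) (υ : F₂ ⟶ (Literature.AlgebraicGeometry.Motives.projectiveSpace n k).left),
          IsBlowup υ (Scheme.IdealSheafData.vanishingIdeal
            (⟨Z, hZ⟩ : Closeds (Literature.AlgebraicGeometry.Motives.projectiveSpace n k).left)) →
          ∀ (F' : Scheme.{0}) (γ' : F' ⟶ F₂) (T' E' : Set F') (Es' : List (Set F')) (K' : Set F'),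
            (∀ R : (∀ G : Scheme.{0}, (G ⟶ F₂) → Set G → Set G → List (Set G) → Set G → Prop),
              R F₂ (𝟙 F₂) (closure (υ ⁻¹' (Set.range ι \ Z))) (υ ⁻¹' Z) [] ∅ →
              TowerPtRegB (Literature.AlgebraicGeometry.Motives.projectiveSpace n k).left F₂ υ R →
              TowerPtRamB (Literature.AlgebraicGeometry.Motives.projectiveSpace n k).left F₂ υ R →
              TowerRoundBPrime (Literature.AlgebraicGeometry.Motives.projectiveSpace n k).left F₂ υ Z hZ R →
              R F' γ' T' E' Es' K') →
            ¬ Literature.AlgebraicGeometry.Resolution.Scheme.IsRegular (redSub F' (closure T') isClosed_closure) := by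
  constructor
  · intro h Z hZ h1 h2 h3 h4 h5 F₂ υ hυ F' γ' T' E' Es' K' hcl hreg
    exact h ⟨Z, hZ, h1, h2, h3, h4, h5, F₂, υ, hυ, F', γ', T', E', Es', K', hcl, hreg⟩
  · rintro h ⟨Z, hZ, h1, h2, h3, h4, h5, F₂, υ, hυ, F', γ', T', E', Es', K', hcl, hreg⟩
    exact h Z hZ h1 h2 h3 h4 h5 F₂ υ hυ F' γ' T' E' Es' K' hcl hreg

/-- **`¬ ReachNoseTowerB`, unfolded** (T23-A «TOWER WITH A BOUNDARY LIST» engine): B-point steps and B rounds `TowerRoundB`. [OURS · L1 W4.5b · pure logic] -/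
theorem not_reachNoseTowerB_iff (k : Type) [Field k] (n : ℕ) (H : Scheme.{0})
    (ι : H ⟶ (Literature.AlgebraicGeometry.Motives.projectiveSpace n k).left) :
    ¬ ReachNoseTowerB k n H ι ↔
      ∀ (Z : Set (Literature.AlgebraicGeometry.Motives.projectiveSpace n k).left) (hZ : IsClosed Z),
        IsLiftableNoseClass₂ k n Z → Z ⊆ Set.range ι → ¬ (Set.range ι ⊆ Z) → Z.Infinite →
        (∀ z : ↥(redSub (Literature.AlgebraicGeometry.Motives.projectiveSpace n k).left Z hZ),
          IsClosed ({z} : Set ↥(redSub (Literature.AlgebraicGeometry.Motives.projectiveSpace n k).left Z hZ)) →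
            ringKrullDim ((redSub (Literature.AlgebraicGeometry.Motives.projectiveSpace n k).left Z hZ).presheaf.stalk z) =
              ((1 : ℕ) : WithBot ℕ∞)) →
        ∀ (F₂ : Scheme.{0}) (υ : F₂ ⟶ (Literature.AlgebraicGeometry.Motives.projectiveSpace n k).left),
          IsBlowup υ (Scheme.IdealSheafData.vanishingIdeal
            (⟨Z, hZ⟩ : Closeds (Literature.AlgebraicGeometry.Motives.projectiveSpace n k).left)) →
          ∀ (F' : Scheme.{0}) (γ' : F' ⟶ F₂) (T' E' : Set F') (Es' : List (Set F')) (K' : Set F'),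
            (∀ R : (∀ G : Scheme.{0}, (G ⟶ F₂) → Set G → Set G → List (Set G) → Set G → Prop),
              R F₂ (𝟙 F₂) (closure (υ ⁻¹' (Set.range ι \ Z))) (υ ⁻¹' Z) [] ∅ →
              TowerPtRegB (Literature.AlgebraicGeometry.Motives.projectiveSpace n k).left F₂ υ R →
              TowerPtRamB (Literature.AlgebraicGeometry.Motives.projectiveSpace n k).left F₂ υ R →
              TowerRoundB (Literature.AlgebraicGeometry.Motives.projectiveSpace n k).left F₂ υ Z hZ R →
              R F' γ' T' E' Es' K') →
            ¬ Literature.AlgebraicGeometry.Resolution.Scheme.IsRegular (redSub F' (closure T') isClosed_closure) := by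
  constructor
  · intro h Z hZ h1 h2 h3 h4 h5 F₂ υ hυ F' γ' T' E' Es' K' hcl hreg
    exact h ⟨Z, hZ, h1, h2, h3, h4, h5, F₂, υ, hυ, F', γ', T', E', Es', K', hcl, hreg⟩
  · rintro h ⟨Z, hZ, h1, h2, h3, h4, h5, F₂, υ, hυ, F', γ', T', E', Es', K', hcl, hreg⟩
    exact h Z hZ h1 h2 h3 h4 h5 F₂ υ hυ F' γ' T' E' Es' K' hcl hreg

/-- **`¬ ReachNoseTower₇`, unfolded** (revision ₇: noses of any genus that are curves; no retained list): point steps `TowerPtReg₂` / `TowerPtRam₂` and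
genus-free Čech rounds `TowerRound₅`. [OURS · L1 W4.5b · pure logic] -/
theorem not_reachNoseTower₇_iff (k : Type) [Field k] (n : ℕ) (H : Scheme.{0})
    (ι : H ⟶ (Literature.AlgebraicGeometry.Motives.projectiveSpace n k).left) :
    ¬ ReachNoseTower₇ k n H ι ↔
      ∀ (Z : Set (Literature.AlgebraicGeometry.Motives.projectiveSpace n k).left) (hZ : IsClosed Z),
        IsLiftableNoseClass₂ k n Z → Z ⊆ Set.range ι → ¬ (Set.range ι ⊆ Z) → Z.Infinite →
        (∀ z : ↥(redSub (Literature.AlgebraicGeometry.Motives.projectiveSpace n k).left Z hZ),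
          IsClosed ({z} : Set ↥(redSub (Literature.AlgebraicGeometry.Motives.projectiveSpace n k).left Z hZ)) →
            ringKrullDim ((redSub (Literature.AlgebraicGeometry.Motives.projectiveSpace n k).left Z hZ).presheaf.stalk z) =
              ((1 : ℕ) : WithBot ℕ∞)) →
        ∀ (F₂ : Scheme.{0}) (υ : F₂ ⟶ (Literature.AlgebraicGeometry.Motives.projectiveSpace n k).left),
          IsBlowup υ (Scheme.IdealSheafData.vanishingIdeal
            (⟨Z, hZ⟩ : Closeds (Literature.AlgebraicGeometry.Motives.projectiveSpace n k).left)) →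
          ∀ (F' : Scheme.{0}) (γ' : F' ⟶ F₂) (T' E' K' : Set F'),
            (∀ R₁ : (∀ G : Scheme.{0}, (G ⟶ F₂) → Set G → Set G → Set G → Prop),
              R₁ F₂ (𝟙 F₂) (closure (υ ⁻¹' (Set.range ι \ Z))) (υ ⁻¹' Z) ∅ →
              TowerPtReg₂ (Literature.AlgebraicGeometry.Motives.projectiveSpace n k).left F₂ υ R₁ →
              TowerPtRam₂ (Literature.AlgebraicGeometry.Motives.projectiveSpace n k).left F₂ υ R₁ →
              TowerRound₅ (Literature.AlgebraicGeometry.Motives.projectiveSpace n k).left F₂ υ Z hZ R₁ →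
              R₁ F' γ' T' E' K') →
            ¬ Literature.AlgebraicGeometry.Resolution.Scheme.IsRegular (redSub F' (closure T') isClosed_closure) := by
  constructor
  · intro h Z hZ h1 h2 h3 h4 h5 F₂ υ hυ F' γ' T' E' K' hcl hreg
    exact h ⟨Z, hZ, h1, h2, h3, h4, h5, F₂, υ, hυ, F', γ', T', E', K', hcl, hreg⟩
  · rintro h ⟨Z, hZ, h1, h2, h3, h4, h5, F₂, υ, hυ, F', γ', T', E', K', hcl, hreg⟩
    exact h Z hZ h1 h2 h3 h4 h5 F₂ υ hυ F' γ' T' E' K' hcl hreg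

/-- **`¬ ReachNoseTower₄`, unfolded** (revision ₄: RATIONAL noses `Z̃ ≅ ℙ¹_k`; point steps `TowerPtReg₂` / `TowerPtRam₂`, rounds `TowerRound₃`).
[OURS · L1 W4.5b · pure logic] -/
theorem not_reachNoseTower₄_iff (k : Type) [Field k] (n : ℕ) (H : Scheme.{0})
    (ι : H ⟶ (Literature.AlgebraicGeometry.Motives.projectiveSpace n k).left) :
    ¬ ReachNoseTower₄ k n H ι ↔
      ∀ (Z : Set (Literature.AlgebraicGeometry.Motives.projectiveSpace n k).left) (hZ : IsClosed Z),
        IsLiftableNoseClass₂ k n Z → Z ⊆ Set.range ι → ¬ (Set.range ι ⊆ Z) → Z.Infinite →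
        Nonempty (redSub (Literature.AlgebraicGeometry.Motives.projectiveSpace n k).left Z hZ ≅
          (Literature.AlgebraicGeometry.Motives.projectiveSpace 1 k).left) →
        ∀ (F₂ : Scheme.{0}) (υ : F₂ ⟶ (Literature.AlgebraicGeometry.Motives.projectiveSpace n k).left),
          IsBlowup υ (Scheme.IdealSheafData.vanishingIdeal
            (⟨Z, hZ⟩ : Closeds (Literature.AlgebraicGeometry.Motives.projectiveSpace n k).left)) →
          ∀ (F' : Scheme.{0}) (γ' : F' ⟶ F₂) (T' E' K' : Set F'),
            (∀ R₁ : (∀ G : Scheme.{0}, (G ⟶ F₂) → Set G → Set G → Set G → Prop),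
              R₁ F₂ (𝟙 F₂) (closure (υ ⁻¹' (Set.range ι \ Z))) (υ ⁻¹' Z) ∅ →
              TowerPtReg₂ (Literature.AlgebraicGeometry.Motives.projectiveSpace n k).left F₂ υ R₁ →
              TowerPtRam₂ (Literature.AlgebraicGeometry.Motives.projectiveSpace n k).left F₂ υ R₁ →
              TowerRound₃ (Literature.AlgebraicGeometry.Motives.projectiveSpace n k).left F₂ υ Z hZ R₁ →
              R₁ F' γ' T' E' K') →
            ¬ Literature.AlgebraicGeometry.Resolution.Scheme.IsRegular (redSub F' (closure T') isClosed_closure) := by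
  constructor
  · intro h Z hZ h1 h2 h3 h4 h5 F₂ υ hυ F' γ' T' E' K' hcl hreg
    exact h ⟨Z, hZ, h1, h2, h3, h4, h5, F₂, υ, hυ, F', γ', T', E', K', hcl, hreg⟩
  · rintro h ⟨Z, hZ, h1, h2, h3, h4, h5, F₂, υ, hυ, F', γ', T', E', K', hcl, hreg⟩
    exact h Z hZ h1 h2 h3 h4 h5 F₂ υ hυ F' γ' T' E' K' hcl hreg

/-- **`¬ NoseHypLiftClassTwo`, unfolded** (blob #10, the «liftable-class₂ nose, then points» engine): `H` escapes it iff for every closed `Z ⊊ ι(H)` of the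
liftable nose class₂ (no curve / infinitude clause: finite noses included), every blow-up `υ` of `Z` and every stage `(F', ρ', T')` reached from
`(F₂, 𝟙, closure υ⁻¹(ι(H) ∖ Z))` by blowing up NON-REGULAR closed points of the reduced strict transform (good or bad points of the ambient alike), the reduced
`closure T'` is NOT regular. [OURS · L1 W4.5b · pure logic] -/
theorem not_noseHypLiftClassTwo_iff (k : Type) [Field k] [IsAlgClosed k] (n : ℕ) (H : Scheme.{0})
    (ι : H ⟶ (Literature.AlgebraicGeometry.Motives.projectiveSpace n k).left) :
    ¬ NoseHypLiftClassTwo k n H ι ↔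
      ∀ (Z : Set (Literature.AlgebraicGeometry.Motives.projectiveSpace n k).left) (hZ : IsClosed Z),
        IsLiftableNoseClass₂ k n Z → Z ⊆ Set.range ι → ¬ (Set.range ι ⊆ Z) →
        ∀ (F₂ : Scheme.{0}) (υ : F₂ ⟶ (Literature.AlgebraicGeometry.Motives.projectiveSpace n k).left),
          IsBlowup υ (Scheme.IdealSheafData.vanishingIdeal
            (⟨Z, hZ⟩ : Closeds (Literature.AlgebraicGeometry.Motives.projectiveSpace n k).left)) →
          ∀ (F' : Scheme.{0}) (ρ' : F' ⟶ F₂) (T' : Set F'),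
            (∀ Q : (∀ F₁ : Scheme.{0}, (F₁ ⟶ F₂) → Set F₁ → Prop),
              Q F₂ (𝟙 F₂) (closure (υ ⁻¹' (Set.range ι \ Z))) →
              (∀ (F₁ F₃ : Scheme.{0}) (ρ : F₁ ⟶ F₂) (T₁ : Set F₁)
                  (x : ↥(vanishingIdeal (⟨closure T₁, isClosed_closure⟩ : Closeds F₁)).subscheme) (υ₁ : F₃ ⟶ F₁)
                  (hx : IsClosed ({((vanishingIdeal (⟨closure T₁, isClosed_closure⟩ : Closeds F₁)).subschemeι x : F₁)} : Set F₁)),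
                Q F₁ ρ T₁ →
                ¬ IsRegularLocalRing ((vanishingIdeal (⟨closure T₁, isClosed_closure⟩ : Closeds F₁)).subscheme.presheaf.stalk x) →
                IsBlowup υ₁ (vanishingIdeal
                  (⟨{((vanishingIdeal (⟨closure T₁, isClosed_closure⟩ : Closeds F₁)).subschemeι x : F₁)}, hx⟩ : Closeds F₁)) →
                Q F₃ (υ₁ ≫ ρ) (closure (υ₁ ⁻¹' (T₁ \ {((vanishingIdeal (⟨closure T₁, isClosed_closure⟩ : Closeds F₁)).subschemeι x : F₁)})))) →
              Q F' ρ' T') →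
            ¬ Literature.AlgebraicGeometry.Resolution.Scheme.IsRegular
                (vanishingIdeal (⟨closure T', isClosed_closure⟩ : Closeds F')).subscheme := by
  constructor
  · intro h Z hZ h1 h2 h3 F₂ υ hυ F' ρ' T' hcl hreg
    exact h ⟨Z, hZ, h1, h2, h3, F₂, υ, hυ, F', ρ', T', hcl, hreg⟩
  · rintro h ⟨Z, hZ, h1, h2, h3, F₂, υ, hυ, F', ρ', T', hcl, hreg⟩
    exact h Z hZ h1 h2 h3 F₂ υ hυ F' ρ' T' hcl hreg

/-- **`¬ NoseHypLiftClass`, unfolded** (blob #9, «liftable-class nose, then points»): as `not_noseHypLiftClassTwo_iff` over the smaller class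
`IsLiftableNoseClass` (smooth complete intersections, smooth determinantal loci, disjoint unions). [OURS · L1 W4.5b · pure logic] -/
theorem not_noseHypLiftClass_iff (k : Type) [Field k] [IsAlgClosed k] (n : ℕ) (H : Scheme.{0})
    (ι : H ⟶ (Literature.AlgebraicGeometry.Motives.projectiveSpace n k).left) :
    ¬ NoseHypLiftClass k n H ι ↔
      ∀ (Z : Set (Literature.AlgebraicGeometry.Motives.projectiveSpace n k).left) (hZ : IsClosed Z),
        IsLiftableNoseClass k n Z → Z ⊆ Set.range ι → ¬ (Set.range ι ⊆ Z) →
        ∀ (F₂ : Scheme.{0}) (υ : F₂ ⟶ (Literature.AlgebraicGeometry.Motives.projectiveSpace n k).left),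
          IsBlowup υ (Scheme.IdealSheafData.vanishingIdeal
            (⟨Z, hZ⟩ : Closeds (Literature.AlgebraicGeometry.Motives.projectiveSpace n k).left)) →
          ∀ (F' : Scheme.{0}) (ρ' : F' ⟶ F₂) (T' : Set F'),
            (∀ Q : (∀ F₁ : Scheme.{0}, (F₁ ⟶ F₂) → Set F₁ → Prop),
              Q F₂ (𝟙 F₂) (closure (υ ⁻¹' (Set.range ι \ Z))) →
              (∀ (F₁ F₃ : Scheme.{0}) (ρ : F₁ ⟶ F₂) (T₁ : Set F₁)
                  (x : ↥(vanishingIdeal (⟨closure T₁, isClosed_closure⟩ : Closeds F₁)).subscheme) (υ₁ : F₃ ⟶ F₁)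
                  (hx : IsClosed ({((vanishingIdeal (⟨closure T₁, isClosed_closure⟩ : Closeds F₁)).subschemeι x : F₁)} : Set F₁)),
                Q F₁ ρ T₁ →
                ¬ IsRegularLocalRing ((vanishingIdeal (⟨closure T₁, isClosed_closure⟩ : Closeds F₁)).subscheme.presheaf.stalk x) →
                IsBlowup υ₁ (vanishingIdeal
                  (⟨{((vanishingIdeal (⟨closure T₁, isClosed_closure⟩ : Closeds F₁)).subschemeι x : F₁)}, hx⟩ : Closeds F₁)) →
                Q F₃ (υ₁ ≫ ρ) (closure (υ₁ ⁻¹' (T₁ \ {((vanishingIdeal (⟨closure T₁, isClosed_closure⟩ : Closeds F₁)).subschemeι x : F₁)})))) →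
              Q F' ρ' T') →
            ¬ Literature.AlgebraicGeometry.Resolution.Scheme.IsRegular
                (vanishingIdeal (⟨closure T', isClosed_closure⟩ : Closeds F')).subscheme := by
  constructor
  · intro h Z hZ h1 h2 h3 F₂ υ hυ F' ρ' T' hcl hreg
    exact h ⟨Z, hZ, h1, h2, h3, F₂, υ, hυ, F', ρ', T', hcl, hreg⟩
  · rintro h ⟨Z, hZ, h1, h2, h3, F₂, υ, hυ, F', ρ', T', hcl, hreg⟩
    exact h Z hZ h1 h2 h3 F₂ υ hυ F' ρ' T' hcl hreg

/-- **`¬ NoseHypDet`, unfolded** (blob #8, «determinantal nose, then points»): `H` escapes it iff for every `(t+1) × t` matrix `M` of forms (degrees `α a + β b`)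
whose maximal-minor locus `V(Δ(M))` is non-empty, contained in `ι(H)`, not all of it, satisfies the Jacobian-pair clause pointwise and is closed, every blow-up
`υ` of `V(Δ(M))` followed by any «then points» chain ends NON-regular. [OURS · L1 W4.5b · pure logic] -/
theorem not_noseHypDet_iff (k : Type) [Field k] [IsAlgClosed k] (n : ℕ) (H : Scheme.{0})
    (ι : H ⟶ (Literature.AlgebraicGeometry.Motives.projectiveSpace n k).left) :
    ¬ NoseHypDet k n H ι ↔
      letI := MvPolynomial.gradedAlgebra (σ := Fin (n + 1)) (R := k);
      ∀ (t : ℕ) (M : Matrix (Fin (t + 1)) (Fin t) (MvPolynomial (Fin (n + 1)) k)) (α : Fin (t + 1) → ℕ) (β : Fin t → ℕ),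
        (∀ a b, M a b ∈ MvPolynomial.homogeneousSubmodule (Fin (n + 1)) k (α a + β b)) →
        Set.Nonempty {y : (Literature.AlgebraicGeometry.Motives.projectiveSpace n k).left | ∀ l : Fin (t + 1),
          (M.submatrix l.succAbove id).det ∈ (y : ProjectiveSpectrum (MvPolynomial.homogeneousSubmodule (Fin (n + 1)) k)).asHomogeneousIdeal} →
        {y : (Literature.AlgebraicGeometry.Motives.projectiveSpace n k).left | ∀ l : Fin (t + 1),
          (M.submatrix l.succAbove id).det ∈ (y : ProjectiveSpectrum (MvPolynomial.homogeneousSubmodule (Fin (n + 1)) k)).asHomogeneousIdeal} ⊆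
            Set.range ι →
        ¬ (Set.range ι ⊆ {y : (Literature.AlgebraicGeometry.Motives.projectiveSpace n k).left | ∀ l : Fin (t + 1),
          (M.submatrix l.succAbove id).det ∈ (y : ProjectiveSpectrum (MvPolynomial.homogeneousSubmodule (Fin (n + 1)) k)).asHomogeneousIdeal}) →
        (∀ y ∈ {y : (Literature.AlgebraicGeometry.Motives.projectiveSpace n k).left | ∀ l : Fin (t + 1),
            (M.submatrix l.succAbove id).det ∈ (y : ProjectiveSpectrum (MvPolynomial.homogeneousSubmodule (Fin (n + 1)) k)).asHomogeneousIdeal},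
          ∃ (a b : Fin (t + 1)) (e : Fin 2 ↪ Fin (n + 1)),
            Matrix.det (Matrix.of fun r s => MvPolynomial.pderiv (e s) (![(M.submatrix a.succAbove id).det, (M.submatrix b.succAbove id).det] r)) ∉
              (y : ProjectiveSpectrum (MvPolynomial.homogeneousSubmodule (Fin (n + 1)) k)).asHomogeneousIdeal) →
        ∀ (hSig : IsClosed {y : (Literature.AlgebraicGeometry.Motives.projectiveSpace n k).left | ∀ l : Fin (t + 1),
            (M.submatrix l.succAbove id).det ∈ (y : ProjectiveSpectrum (MvPolynomial.homogeneousSubmodule (Fin (n + 1)) k)).asHomogeneousIdeal})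
          (F₂ : Scheme.{0}) (υ : F₂ ⟶ (Literature.AlgebraicGeometry.Motives.projectiveSpace n k).left),
          IsBlowup υ (Scheme.IdealSheafData.vanishingIdeal
            (⟨{y : (Literature.AlgebraicGeometry.Motives.projectiveSpace n k).left | ∀ l : Fin (t + 1),
              (M.submatrix l.succAbove id).det ∈ (y : ProjectiveSpectrum (MvPolynomial.homogeneousSubmodule (Fin (n + 1)) k)).asHomogeneousIdeal}, hSig⟩ :
              Closeds (Literature.AlgebraicGeometry.Motives.projectiveSpace n k).left)) →
          ∀ (F' : Scheme.{0}) (ρ' : F' ⟶ F₂) (T' : Set F'),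
            (∀ Q : (∀ F₁ : Scheme.{0}, (F₁ ⟶ F₂) → Set F₁ → Prop),
              Q F₂ (𝟙 F₂) (closure (υ ⁻¹' (Set.range ι \ {y : (Literature.AlgebraicGeometry.Motives.projectiveSpace n k).left | ∀ l : Fin (t + 1),
                (M.submatrix l.succAbove id).det ∈ (y : ProjectiveSpectrum (MvPolynomial.homogeneousSubmodule (Fin (n + 1)) k)).asHomogeneousIdeal}))) →
              (∀ (F₁ F₃ : Scheme.{0}) (ρ : F₁ ⟶ F₂) (T₁ : Set F₁)
                  (x : ↥(vanishingIdeal (⟨closure T₁, isClosed_closure⟩ : Closeds F₁)).subscheme) (υ₁ : F₃ ⟶ F₁)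
                  (hx : IsClosed ({((vanishingIdeal (⟨closure T₁, isClosed_closure⟩ : Closeds F₁)).subschemeι x : F₁)} : Set F₁)),
                Q F₁ ρ T₁ →
                ¬ IsRegularLocalRing ((vanishingIdeal (⟨closure T₁, isClosed_closure⟩ : Closeds F₁)).subscheme.presheaf.stalk x) →
                IsBlowup υ₁ (vanishingIdeal
                  (⟨{((vanishingIdeal (⟨closure T₁, isClosed_closure⟩ : Closeds F₁)).subschemeι x : F₁)}, hx⟩ : Closeds F₁)) →
                Q F₃ (υ₁ ≫ ρ) (closure (υ₁ ⁻¹' (T₁ \ {((vanishingIdeal (⟨closure T₁, isClosed_closure⟩ : Closeds F₁)).subschemeι x : F₁)})))) →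
              Q F' ρ' T') →
            ¬ Literature.AlgebraicGeometry.Resolution.Scheme.IsRegular
                (vanishingIdeal (⟨closure T', isClosed_closure⟩ : Closeds F')).subscheme := by
  constructor
  · intro h t M α β hdeg hne hsub hnsub hjac hSig F₂ υ hυ F' ρ' T' hcl hreg
    exact h ⟨t, M, α, β, hdeg, hne, hsub, hnsub, hjac, hSig, F₂, υ, hυ, F', ρ', T', hcl, hreg⟩
  · rintro h ⟨t, M, α, β, hdeg, hne, hsub, hnsub, hjac, hSig, F₂, υ, hυ, F', ρ', T', hcl, hreg⟩
    exact h t M α β hdeg hne hsub hnsub hjac hSig F₂ υ hυ F' ρ' T' hcl hreg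

/-- **`¬ NoseHypCI`, unfolded** (blob #7, «complete-intersection nose, then points»): `H` escapes it iff for every family of `c` forms `f i` of degrees `d i ≥ 1`
whose common zero set `V(f)` is non-empty, contained in `ι(H)`, not all of it, and satisfies the `c × c` Jacobian-minor clause pointwise (and is closed), every
blow-up `υ` of `V(f)` followed by any «then points» chain ends NON-regular. [OURS · L1 W4.5b · pure logic] -/
theorem not_noseHypCI_iff (k : Type) [Field k] [IsAlgClosed k] (n : ℕ) (H : Scheme.{0})
    (ι : H ⟶ (Literature.AlgebraicGeometry.Motives.projectiveSpace n k).left) :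
    ¬ NoseHypCI k n H ι ↔
      letI := MvPolynomial.gradedAlgebra (σ := Fin (n + 1)) (R := k);
      ∀ (c : ℕ) (f : Fin c → MvPolynomial (Fin (n + 1)) k) (d : Fin c → ℕ),
        (∀ i, 1 ≤ d i ∧ f i ∈ MvPolynomial.homogeneousSubmodule (Fin (n + 1)) k (d i)) →
        Set.Nonempty {y : (Literature.AlgebraicGeometry.Motives.projectiveSpace n k).left | ∀ i,
          f i ∈ (y : ProjectiveSpectrum (MvPolynomial.homogeneousSubmodule (Fin (n + 1)) k)).asHomogeneousIdeal} →
        {y : (Literature.AlgebraicGeometry.Motives.projectiveSpace n k).left | ∀ i,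
          f i ∈ (y : ProjectiveSpectrum (MvPolynomial.homogeneousSubmodule (Fin (n + 1)) k)).asHomogeneousIdeal} ⊆ Set.range ι →
        ¬ (Set.range ι ⊆ {y : (Literature.AlgebraicGeometry.Motives.projectiveSpace n k).left | ∀ i,
          f i ∈ (y : ProjectiveSpectrum (MvPolynomial.homogeneousSubmodule (Fin (n + 1)) k)).asHomogeneousIdeal}) →
        (∀ y ∈ {y : (Literature.AlgebraicGeometry.Motives.projectiveSpace n k).left | ∀ i,
            f i ∈ (y : ProjectiveSpectrum (MvPolynomial.homogeneousSubmodule (Fin (n + 1)) k)).asHomogeneousIdeal},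
          ∃ e : Fin c ↪ Fin (n + 1), Matrix.det (Matrix.of fun i j => MvPolynomial.pderiv (e j) (f i)) ∉
            (y : ProjectiveSpectrum (MvPolynomial.homogeneousSubmodule (Fin (n + 1)) k)).asHomogeneousIdeal) →
        ∀ (hSig : IsClosed {y : (Literature.AlgebraicGeometry.Motives.projectiveSpace n k).left | ∀ i,
            f i ∈ (y : ProjectiveSpectrum (MvPolynomial.homogeneousSubmodule (Fin (n + 1)) k)).asHomogeneousIdeal})
          (F₂ : Scheme.{0}) (υ : F₂ ⟶ (Literature.AlgebraicGeometry.Motives.projectiveSpace n k).left),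
          IsBlowup υ (Scheme.IdealSheafData.vanishingIdeal
            (⟨{y : (Literature.AlgebraicGeometry.Motives.projectiveSpace n k).left | ∀ i,
              f i ∈ (y : ProjectiveSpectrum (MvPolynomial.homogeneousSubmodule (Fin (n + 1)) k)).asHomogeneousIdeal}, hSig⟩ :
              Closeds (Literature.AlgebraicGeometry.Motives.projectiveSpace n k).left)) →
          ∀ (F' : Scheme.{0}) (ρ' : F' ⟶ F₂) (T' : Set F'),
            (∀ Q : (∀ F₁ : Scheme.{0}, (F₁ ⟶ F₂) → Set F₁ → Prop),
              Q F₂ (𝟙 F₂) (closure (υ ⁻¹' (Set.range ι \ {y : (Literature.AlgebraicGeometry.Motives.projectiveSpace n k).left | ∀ i,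
                f i ∈ (y : ProjectiveSpectrum (MvPolynomial.homogeneousSubmodule (Fin (n + 1)) k)).asHomogeneousIdeal}))) →
              (∀ (F₁ F₃ : Scheme.{0}) (ρ : F₁ ⟶ F₂) (T₁ : Set F₁)
                  (x : ↥(vanishingIdeal (⟨closure T₁, isClosed_closure⟩ : Closeds F₁)).subscheme) (υ₁ : F₃ ⟶ F₁)
                  (hx : IsClosed ({((vanishingIdeal (⟨closure T₁, isClosed_closure⟩ : Closeds F₁)).subschemeι x : F₁)} : Set F₁)),
                Q F₁ ρ T₁ →
                ¬ IsRegularLocalRing ((vanishingIdeal (⟨closure T₁, isClosed_closure⟩ : Closeds F₁)).subscheme.presheaf.stalk x) →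
                IsBlowup υ₁ (vanishingIdeal
                  (⟨{((vanishingIdeal (⟨closure T₁, isClosed_closure⟩ : Closeds F₁)).subschemeι x : F₁)}, hx⟩ : Closeds F₁)) →
                Q F₃ (υ₁ ≫ ρ) (closure (υ₁ ⁻¹' (T₁ \ {((vanishingIdeal (⟨closure T₁, isClosed_closure⟩ : Closeds F₁)).subschemeι x : F₁)})))) →
              Q F' ρ' T') →
            ¬ Literature.AlgebraicGeometry.Resolution.Scheme.IsRegular
                (vanishingIdeal (⟨closure T', isClosed_closure⟩ : Closeds F')).subscheme := by
  constructor
  · intro h c f d hdeg hne hsub hnsub hjac hSig F₂ υ hυ F' ρ' T' hcl hreg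
    exact h ⟨c, f, d, hdeg, hne, hsub, hnsub, hjac, hSig, F₂, υ, hυ, F', ρ', T', hcl, hreg⟩
  · rintro h ⟨c, f, d, hdeg, hne, hsub, hnsub, hjac, hSig, F₂, υ, hυ, F', ρ', T', hcl, hreg⟩
    exact h c f d hdeg hne hsub hnsub hjac hSig F₂ υ hυ F' ρ' T' hcl hreg

end Summit.ResolutionOfSingularities.ResolutionOfSingularities.Cruxes.EquisingularLiftNat.Sections

end
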